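import Mathlib
import Literature.Barriers.ValiantsHypothesis.AlgebraicNaturalProofs
import Summits.ValiantsHypothesis.ValiantsHypothesis.Theorems.BarrierLeverPartitionMinorsHitByVPHiddenStates

/-!
# Route BarrierLever — item `PartitionMinorsHitByVP` (stmt-ValiantsHypothesis-19717):
# the GADGET JOIN DOOR (line `hidden_states`, programme BLOCK PEELING)

Helper file (`--supports stmt-ValiantsHypothesis-19717`; cell valiant-natproofs, rung V4, 𝒟-side of door (c);
prover seat val-np-p3 gen 20). Definition-free. Closes NO item.

WHY. The hidden-state / wide-join doors (`…HiddenStates`, `…HiddenStatesJoin`, `HiddenStatesLine.stub_joinDoorWide`)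
enumerate, per piece, a THRESHOLD family of state sets for an ADDITIVE weight `J ↦ W p + Σ_{k∈J} wt p k`. Block designs
of the block-peeling programme (matched pairs `{q}, {q'}, {q,q'}`, triangles, `B₂([b])` blocks; seat memo
MEMO-blockpeeling-valnp3-g20 §6) are NOT such threshold families (an additive threshold family of pairs is the edge set
of a threshold graph). THE GADGET WITNESS replaces the per-state factors `(1 + λ_k ∏_v (1 + g_{kv} X_v))` by one
GADGET per SLOT `l < t`, `G_{p,l} = Σ_{o < s} w_{p,l,o} ∏_v (1 + d_{p,l,o,v} X_v)` (option `o` of slot `l` contributes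
the vector `d_{p,l,o}`; weights `w = t₀^{cost}`):
`F = Σ_p κ_p ∏_v (1 + c^p_v X_v) ∏_{l<t} G_{p,l}`. Its coefficient on `x^U y^W` is
`Σ_{(p,φ)} κ_p (∏_l w_{p,l,φ l}) ∏_{a∈U} (c^p + Σ_l d_{p,l,φ l})_{x_a} ∏_{c∈W} (…)_{y_c}` over ALL option choices
`φ : Fin t → Fin s` (`coeff_partition_gadgetJoin`, via `Finset.prod_univ_sum`), i.e. `A · diag(t₀^{ω}) · Bᵀ` over the
hidden index set `Fin m × (Fin t → Fin s)` with the SLOT-ADDITIVE weight `ω(p,φ) = W p + Σ_l cost p l (φ l)`; the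
Cauchy–Binet leading term `exists_eval_det_hiddenSum_ne_zero` (which takes any weight) does the rest.

* `coeff_elemProd_mul_prod`, `coeff_gadgetF`, `coeff_partition_gadgetF`, `coeff_partition_gadgetJoin` (coefficients);
  `complexity_gadgetF_le`, `complexity_gadgetJoin_le` (size `≤ m (6h + t (s (6h+1) + s) + t + 2) + m`).
* **`partitionMinor_hit_of_gadgetJoin`** (THE GADGET JOIN DOOR, explicit size): an injective threshold family
  `e : Fin r → Fin m × (Fin t → Fin s)` of the slot-additive weight and per-piece base / option vectors making BOTH
  matrices `[∏_{a∈u i} (cx p a + Σ_l dx p l (φ l) a)]_{i,(p,φ)=e k}` nonsingular ⇒ `(u, w)` is hit in degree `≤ 2h`;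
  **`…_mem`**: `h ≥ 3`, `m ≤ 2h`, `t ≤ h³`, `t·s ≤ 4h³` ⇒ inside `SmallCircuits ℂ (h+h) 8`.
* **`partitionMinor_hit_of_gadgetStates_mem`** (state form): option vectors = subset sums of a state table over pairwise
  disjoint blocks, columns `cols k = ⋃_l D p l (φ_k l)`: the matrices are the block-additive matrices
  `[∏_{a∈u i} (T p none a + Σ_{q ∈ cols k} T p (some q) a)]` of `SimplexJoin.good_of_uniform_pieces_join`, so UNIFORM block
  pieces (matching pieces: `Matching.exists_table`) compose as in the wide join door, the threshold legality now bearing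
  on the SLOT costs (empty option `0`, single `2`, pair `3`, threshold `3`: one active block per column).

WHAT THIS IS NOT: no design is built here and no piece is proved uniform here; item 19717 stays OPEN; nothing on
crux 14610 or VP ≠ VNP.
-/

set_option linter.dupNamespace false

namespace Summit.ValiantsHypothesis.ValiantsHypothesis.Theorems.BarrierLever.HiddenStates

open Finset MvPolynomial Matrix
open Literature.Barriers.ValiantsHypothesis Literature.Computability.AlgebraicComplexity
open Summit.ValiantsHypothesis.ValiantsHypothesis.Theorems.BarrierLever.AdditiveDoor
  (coeff_squarefree_prod_one_add_C_mul_X truncation_spec degree_partitionExpo_le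
    complexity_one_add_C_mul_X_le partitionExpo_le_one)

noncomputable section

namespace GadgetDoor

/-! ## 1. Coefficients of the gadget witness -/

section Coeff

variable {σ κ : Type*} [Fintype σ] [DecidableEq σ] [Fintype κ] [DecidableEq κ]

/-- Square-free coefficients of `∏_v (1 + c_v X_v) · ∏_k ∏_v (1 + g_{k v} X_v)`: the coefficient of `X^d` is
`∏_{s ∈ supp d} (c_s + Σ_k g_{k s})` (each variable of `d` is supplied by the base factor or by one of the `k`-factors). -/
theorem coeff_elemProd_mul_prod (c : σ → ℂ) (g : κ → σ → ℂ) (d : σ →₀ ℕ) (hd : ∀ x, d x ≤ 1) :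
    coeff d ((∏ v : σ, (1 + C (c v) * X v)) * ∏ k : κ, ∏ v : σ, (1 + C (g k v) * X v) :
        MvPolynomial σ ℂ) = ∏ x ∈ d.support, (c x + ∑ k : κ, g k x) := by
  set tab : Option κ → σ → ℂ := fun o => o.elim c g with htab
  have hprod : ((∏ v : σ, (1 + C (c v) * X v)) * ∏ k : κ, ∏ v : σ, (1 + C (g k v) * X v) :
      MvPolynomial σ ℂ) =
      ∏ e ∈ (Finset.univ : Finset (Option κ)) ×ˢ (Finset.univ : Finset σ),
        (1 + C (Function.uncurry tab e) * X (Prod.snd e)) := by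
    rw [Finset.prod_product, Fintype.prod_option]
    rfl
  rw [hprod, coeff_squarefree_prod_one_add_C_mul_X _ Prod.snd (Function.uncurry tab) d hd]
  refine Finset.prod_congr rfl fun x _ => ?_
  rw [Finset.sum_filter, Finset.sum_product, Fintype.sum_option]
  simp only [htab, Function.uncurry_apply_pair, Option.elim_none, Option.elim_some, Finset.sum_ite_eq',
    Finset.mem_univ, if_true]

/-- **Coefficients of the one-piece gadget witness.** For a square-free exponent `d`,
`coeff_d (∏_v (1 + c_v X_v) · ∏_l (Σ_o w_{l o} ∏_v (1 + g_{l o v} X_v)))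
  = Σ_{φ : Fin t → Fin s} (∏_l w_{l, φ l}) · ∏_{x ∈ supp d} (c_x + Σ_l g_{l, φ l, x})`. -/
theorem coeff_gadgetF {t s : ℕ} (c : σ → ℂ) (w : Fin t → Fin s → ℂ) (g : Fin t → Fin s → σ → ℂ)
    (d : σ →₀ ℕ) (hd : ∀ x, d x ≤ 1) :
    coeff d ((∏ v : σ, (1 + C (c v) * X v)) *
        ∏ l : Fin t, ∑ o : Fin s, C (w l o) * ∏ v : σ, (1 + C (g l o v) * X v) : MvPolynomial σ ℂ) =
      ∑ φ : Fin t → Fin s, (∏ l, w l (φ l)) * ∏ x ∈ d.support, (c x + ∑ l, g l (φ l) x) := by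
  have hexp : (∏ l : Fin t, ∑ o : Fin s, C (w l o) * ∏ v : σ, (1 + C (g l o v) * X v) :
      MvPolynomial σ ℂ) =
      ∑ φ : Fin t → Fin s, C (∏ l, w l (φ l)) * ∏ l, ∏ v : σ, (1 + C (g l (φ l) v) * X v) := by
    rw [Finset.prod_univ_sum (fun _ => (Finset.univ : Finset (Fin s)))
      (fun l o => C (w l o) * ∏ v : σ, (1 + C (g l o v) * X v)), Fintype.piFinset_univ]
    refine Finset.sum_congr rfl fun φ _ => ?_
    rw [Finset.prod_mul_distrib, map_prod]
  rw [hexp, Finset.mul_sum, coeff_sum]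
  refine Finset.sum_congr rfl fun φ _ => ?_
  rw [mul_left_comm, coeff_C_mul, coeff_elemProd_mul_prod c (fun l => g l (φ l)) d hd]

end Coeff

variable {h : ℕ}

/-- **The one-piece gadget partition matrix.** On the layout `(U, W)` the coefficient of `x^U y^W` in the gadget
witness is `Σ_φ (∏_l w_{l,φ l}) · ∏_{a∈U} (c + Σ_l g_{l,φ l})(x_a) · ∏_{c'∈W} (c + Σ_l g_{l,φ l})(y_{c'})`. -/
theorem coeff_partition_gadgetF {t s : ℕ} (c : Fin (h + h) → ℂ) (w : Fin t → Fin s → ℂ)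
    (g : Fin t → Fin s → Fin (h + h) → ℂ) (U W : Finset (Fin h)) :
    coeff (∑ a ∈ U, Finsupp.single (Fin.castAdd h a) 1 + ∑ c ∈ W, Finsupp.single (Fin.natAdd h c) 1)
      ((∏ v : Fin (h + h), (1 + C (c v) * X v)) *
        ∏ l : Fin t, ∑ o : Fin s, C (w l o) * ∏ v : Fin (h + h), (1 + C (g l o v) * X v) :
        MvPolynomial (Fin (h + h)) ℂ) =
      ∑ φ : Fin t → Fin s, (∏ l, w l (φ l)) *
        ((∏ a ∈ U, (c (Fin.castAdd h a) + ∑ l, g l (φ l) (Fin.castAdd h a))) *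
          ∏ c' ∈ W, (c (Fin.natAdd h c') + ∑ l, g l (φ l) (Fin.natAdd h c'))) := by
  rw [coeff_gadgetF c w g _ (partitionExpo_le_one U W)]
  refine Finset.sum_congr rfl fun φ _ => ?_
  rw [prod_support_partitionExpo U W (fun x => c x + ∑ l, g l (φ l) x)]

/-- **The partition matrix of the gadget JOIN witness** `Σ_p κ_p ∏_v (1 + c^p_v X_v) ∏_l G_{p,l}`. -/
theorem coeff_partition_gadgetJoin {m t s : ℕ} (kap : Fin m → ℂ) (c : Fin m → Fin (h + h) → ℂ)
    (w : Fin m → Fin t → Fin s → ℂ) (g : Fin m → Fin t → Fin s → Fin (h + h) → ℂ) (U W : Finset (Fin h)) :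
    coeff (∑ a ∈ U, Finsupp.single (Fin.castAdd h a) 1 + ∑ c ∈ W, Finsupp.single (Fin.natAdd h c) 1)
      (∑ p : Fin m, C (kap p) * ((∏ v : Fin (h + h), (1 + C (c p v) * X v)) *
        ∏ l : Fin t, ∑ o : Fin s, C (w p l o) * ∏ v : Fin (h + h), (1 + C (g p l o v) * X v)) :
        MvPolynomial (Fin (h + h)) ℂ) =
      ∑ p : Fin m, ∑ φ : Fin t → Fin s, kap p * (∏ l, w p l (φ l)) *
        ((∏ a ∈ U, (c p (Fin.castAdd h a) + ∑ l, g p l (φ l) (Fin.castAdd h a))) *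
          ∏ c' ∈ W, (c p (Fin.natAdd h c') + ∑ l, g p l (φ l) (Fin.natAdd h c'))) := by
  rw [coeff_sum]
  refine Finset.sum_congr rfl fun p _ => ?_
  rw [coeff_C_mul, coeff_partition_gadgetF, Finset.mul_sum]
  refine Finset.sum_congr rfl fun φ _ => ?_
  ring

/-! ## 2. Size -/

/-- **Size of the one-piece gadget witness**: `≤ 3(2h) + (t (s (3(2h)+1) + s) + t) + 1`. -/
theorem complexity_gadgetF_le {t s : ℕ} (c : Fin (h + h) → ℂ) (w : Fin t → Fin s → ℂ)
    (g : Fin t → Fin s → Fin (h + h) → ℂ) :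
    complexity ((∏ v : Fin (h + h), (1 + C (c v) * X v)) *
        ∏ l : Fin t, ∑ o : Fin s, C (w l o) * ∏ v : Fin (h + h), (1 + C (g l o v) * X v) :
        MvPolynomial (Fin (h + h)) ℂ) ≤
      3 * (h + h) + (t * (s * (3 * (h + h) + 1) + s) + t) + 1 := by
  have hopt : ∀ (l : Fin t) (o : Fin s), complexity (C (w l o) *
      ∏ v : Fin (h + h), (1 + C (g l o v) * X v) : MvPolynomial (Fin (h + h)) ℂ) ≤ 3 * (h + h) + 1 := by
    intro l o
    calc complexity (C (w l o) * ∏ v : Fin (h + h), (1 + C (g l o v) * X v) : MvPolynomial (Fin (h + h)) ℂ)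
        ≤ complexity (C (w l o) : MvPolynomial (Fin (h + h)) ℂ) +
            complexity (∏ v : Fin (h + h), (1 + C (g l o v) * X v) : MvPolynomial (Fin (h + h)) ℂ) + 1 :=
          complexity_mul_le_holds _ _
      _ ≤ 0 + 3 * (h + h) + 1 := by
          rw [complexity_C_holds]
          gcongr
          exact complexity_elemProd_le _
      _ = 3 * (h + h) + 1 := by ring
  have hslot : ∀ l : Fin t, complexity (∑ o : Fin s, C (w l o) *
      ∏ v : Fin (h + h), (1 + C (g l o v) * X v) : MvPolynomial (Fin (h + h)) ℂ) ≤
      s * (3 * (h + h) + 1) + s := by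
    intro l
    calc complexity (∑ o : Fin s, C (w l o) * ∏ v : Fin (h + h), (1 + C (g l o v) * X v) :
          MvPolynomial (Fin (h + h)) ℂ)
        ≤ ∑ o : Fin s, complexity (C (w l o) * ∏ v : Fin (h + h), (1 + C (g l o v) * X v) :
            MvPolynomial (Fin (h + h)) ℂ) + (Finset.univ : Finset (Fin s)).card :=
          complexity_finset_sum_le _ _
      _ ≤ ∑ _o : Fin s, (3 * (h + h) + 1) + (Finset.univ : Finset (Fin s)).card := by
          gcongr with o _; exact hopt l o
      _ = s * (3 * (h + h) + 1) + s := by simp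
  calc complexity ((∏ v : Fin (h + h), (1 + C (c v) * X v)) *
        ∏ l : Fin t, ∑ o : Fin s, C (w l o) * ∏ v : Fin (h + h), (1 + C (g l o v) * X v) :
        MvPolynomial (Fin (h + h)) ℂ)
      ≤ complexity (∏ v : Fin (h + h), (1 + C (c v) * X v) : MvPolynomial (Fin (h + h)) ℂ) +
          complexity (∏ l : Fin t, ∑ o : Fin s, C (w l o) * ∏ v : Fin (h + h), (1 + C (g l o v) * X v) :
            MvPolynomial (Fin (h + h)) ℂ) + 1 := complexity_mul_le_holds _ _
    _ ≤ 3 * (h + h) + (∑ l : Fin t, complexity (∑ o : Fin s, C (w l o) *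
          ∏ v : Fin (h + h), (1 + C (g l o v) * X v) : MvPolynomial (Fin (h + h)) ℂ) +
          (Finset.univ : Finset (Fin t)).card) + 1 := by
        gcongr
        · exact complexity_elemProd_le _
        · exact complexity_finset_prod_le _ _
    _ ≤ 3 * (h + h) + (∑ _l : Fin t, (s * (3 * (h + h) + 1) + s) + (Finset.univ : Finset (Fin t)).card) + 1 := by
        gcongr with l _; exact hslot l
    _ = 3 * (h + h) + (t * (s * (3 * (h + h) + 1) + s) + t) + 1 := by simp

/-- **Size of the gadget join witness**: `≤ m (3(2h) + (t (s (3(2h)+1) + s) + t) + 2) + m`. -/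
theorem complexity_gadgetJoin_le {m t s : ℕ} (kap : Fin m → ℂ) (c : Fin m → Fin (h + h) → ℂ)
    (w : Fin m → Fin t → Fin s → ℂ) (g : Fin m → Fin t → Fin s → Fin (h + h) → ℂ) :
    complexity (∑ p : Fin m, C (kap p) * ((∏ v : Fin (h + h), (1 + C (c p v) * X v)) *
        ∏ l : Fin t, ∑ o : Fin s, C (w p l o) * ∏ v : Fin (h + h), (1 + C (g p l o v) * X v)) :
        MvPolynomial (Fin (h + h)) ℂ) ≤
      m * (3 * (h + h) + (t * (s * (3 * (h + h) + 1) + s) + t) + 1 + 1) + m := by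
  have hterm : ∀ p : Fin m, complexity (C (kap p) * ((∏ v : Fin (h + h), (1 + C (c p v) * X v)) *
        ∏ l : Fin t, ∑ o : Fin s, C (w p l o) * ∏ v : Fin (h + h), (1 + C (g p l o v) * X v)) :
        MvPolynomial (Fin (h + h)) ℂ) ≤ 3 * (h + h) + (t * (s * (3 * (h + h) + 1) + s) + t) + 1 + 1 := by
    intro p
    calc complexity (C (kap p) * ((∏ v : Fin (h + h), (1 + C (c p v) * X v)) *
          ∏ l : Fin t, ∑ o : Fin s, C (w p l o) * ∏ v : Fin (h + h), (1 + C (g p l o v) * X v)) :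
          MvPolynomial (Fin (h + h)) ℂ)
        ≤ complexity (C (kap p) : MvPolynomial (Fin (h + h)) ℂ) +
            complexity ((∏ v : Fin (h + h), (1 + C (c p v) * X v)) *
              ∏ l : Fin t, ∑ o : Fin s, C (w p l o) * ∏ v : Fin (h + h), (1 + C (g p l o v) * X v) :
              MvPolynomial (Fin (h + h)) ℂ) + 1 := complexity_mul_le_holds _ _
      _ ≤ 0 + (3 * (h + h) + (t * (s * (3 * (h + h) + 1) + s) + t) + 1) + 1 := by
          rw [complexity_C_holds]
          gcongr
          exact complexity_gadgetF_le (c p) (w p) (g p)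
      _ = _ := by ring
  calc complexity (∑ p : Fin m, C (kap p) * ((∏ v : Fin (h + h), (1 + C (c p v) * X v)) *
        ∏ l : Fin t, ∑ o : Fin s, C (w p l o) * ∏ v : Fin (h + h), (1 + C (g p l o v) * X v)) :
        MvPolynomial (Fin (h + h)) ℂ)
      ≤ ∑ p : Fin m, complexity (C (kap p) * ((∏ v : Fin (h + h), (1 + C (c p v) * X v)) *
          ∏ l : Fin t, ∑ o : Fin s, C (w p l o) * ∏ v : Fin (h + h), (1 + C (g p l o v) * X v)) :
          MvPolynomial (Fin (h + h)) ℂ) + (Finset.univ : Finset (Fin m)).card :=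
        complexity_finset_sum_le _ _
    _ ≤ ∑ _p : Fin m, (3 * (h + h) + (t * (s * (3 * (h + h) + 1) + s) + t) + 1 + 1) +
          (Finset.univ : Finset (Fin m)).card := by gcongr with p _; exact hterm p
    _ = m * (3 * (h + h) + (t * (s * (3 * (h + h) + 1) + s) + t) + 1 + 1) + m := by simp

/-! ## 3. The door -/

/-- **THE GADGET JOIN DOOR (explicit size).** Let `(u, w)` be a layout of size `r`,
`e : Fin r → Fin m × (Fin t → Fin s)` an injective THRESHOLD family of (piece, option choice per slot) for the
slot-additive weight `(p, φ) ↦ W p + Σ_l cost p l (φ l)` (every index outside its range is heavier than every member),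
`cx cy : Fin m → Fin h → ℂ` base vectors and `dx dy : Fin m → Fin t → Fin s → Fin h → ℂ` option vectors (one family per
piece and side) whose matrices `[∏_{a ∈ u i} (cx p a + Σ_l dx p l (φ l) a)]_{i, (p,φ) = e k}` and the `y`-analogue are BOTH
nonsingular. Then some `f` of degree `≤ 2h` and size `≤ (2h+2)² (m (6h + t (s (6h+1) + s) + t + 2) + m) + 2h + 1` has a
nonsingular partition matrix on `(u, w)`. -/
theorem partitionMinor_hit_of_gadgetJoin (h m t s r : ℕ) (u w : Fin r → Finset (Fin h))
    (e : Fin r → Fin m × (Fin t → Fin s)) (he : Function.Injective e) (W : Fin m → ℕ)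
    (cost : Fin m → Fin t → Fin s → ℕ)
    (hthr : ∀ x : Fin m × (Fin t → Fin s), x ∉ Set.range e →
      ∀ k, W (e k).1 + ∑ l, cost (e k).1 l ((e k).2 l) < W x.1 + ∑ l, cost x.1 l (x.2 l))
    (cx cy : Fin m → Fin h → ℂ) (dx dy : Fin m → Fin t → Fin s → Fin h → ℂ)
    (hx : (Matrix.of fun i k : Fin r =>
      ∏ a ∈ u i, (cx (e k).1 a + ∑ l, dx (e k).1 l ((e k).2 l) a)).det ≠ 0)
    (hy : (Matrix.of fun j k : Fin r =>
      ∏ c ∈ w j, (cy (e k).1 c + ∑ l, dy (e k).1 l ((e k).2 l) c)).det ≠ 0) :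
    ∃ f : MvPolynomial (Fin (h + h)) ℂ, f.totalDegree ≤ h + h ∧
      complexity f ≤ (h + h + 2) ^ 2 *
        (m * (3 * (h + h) + (t * (s * (3 * (h + h) + 1) + s) + t) + 1 + 1) + m) + (h + h + 1) ∧
      (Matrix.of fun i j : Fin r => MvPolynomial.coeff
        (∑ a ∈ u i, Finsupp.single (Fin.castAdd h a) 1 +
          ∑ c ∈ w j, Finsupp.single (Fin.natAdd h c) 1) f).det ≠ 0 := by
  classical
  -- the two matrices over ALL hidden indices (piece, option choice)
  set A : Matrix (Fin r) (Fin m × (Fin t → Fin s)) ℂ :=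
    Matrix.of fun i x => ∏ a ∈ u i, (cx x.1 a + ∑ l, dx x.1 l (x.2 l) a) with hA
  set B : Matrix (Fin r) (Fin m × (Fin t → Fin s)) ℂ :=
    Matrix.of fun j x => ∏ c ∈ w j, (cy x.1 c + ∑ l, dy x.1 l (x.2 l) c) with hB
  set ω : Fin m × (Fin t → Fin s) → ℕ := fun x => W x.1 + ∑ l, cost x.1 l (x.2 l) with hω
  have hAe : (A.submatrix id e).det ≠ 0 := hx
  have hBe : (B.submatrix id e).det ≠ 0 := hy
  have hthr' : ∀ x, x ∉ Set.range e → ∀ i, ω (e i) < ω x := fun x hxr i => hthr x hxr i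
  obtain ⟨t₀, ht₀⟩ := exists_eval_det_hiddenSum_ne_zero A B ω e he hthr' hAe hBe
  -- the witness: combined base / option vectors on `Fin (h + h)`, weights `t₀ ^ cost`, `κ_p = t₀ ^ W p`
  set c : Fin m → Fin (h + h) → ℂ := fun p v => Fin.addCases (cx p) (cy p) v with hc
  set g : Fin m → Fin t → Fin s → Fin (h + h) → ℂ :=
    fun p l o v => Fin.addCases (dx p l o) (dy p l o) v with hg
  set wgt : Fin m → Fin t → Fin s → ℂ := fun p l o => t₀ ^ cost p l o with hwgt
  set kap : Fin m → ℂ := fun p => t₀ ^ W p with hkap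
  set F : MvPolynomial (Fin (h + h)) ℂ := ∑ p : Fin m, C (kap p) *
    ((∏ v : Fin (h + h), (1 + C (c p v) * X v)) *
      ∏ l : Fin t, ∑ o : Fin s, C (wgt p l o) * ∏ v : Fin (h + h), (1 + C (g p l o v) * X v)) with hF
  obtain ⟨hdeg, hcoeff, hsize⟩ := truncation_spec F (h + h)
  refine ⟨∑ d ∈ Finset.range (h + h + 1), homogeneousComponent d F, hdeg, ?_, ?_⟩
  · exact hsize.trans (by have := complexity_gadgetJoin_le kap c wgt g; rw [← hF] at this; gcongr)
  · have hmat : (Matrix.of fun i j : Fin r => MvPolynomial.coeff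
        (∑ a ∈ u i, Finsupp.single (Fin.castAdd h a) 1 +
          ∑ c ∈ w j, Finsupp.single (Fin.natAdd h c) 1)
        (∑ d ∈ Finset.range (h + h + 1), homogeneousComponent d F)) =
        Matrix.of fun i j : Fin r => ∑ x : Fin m × (Fin t → Fin s), A i x * B j x * t₀ ^ ω x := by
      refine Matrix.ext fun i j => ?_
      rw [Matrix.of_apply, Matrix.of_apply, hcoeff _ (degree_partitionExpo_le _ _), hF,
        coeff_partition_gadgetJoin, Fintype.sum_prod_type]
      refine Finset.sum_congr rfl fun p _ => Finset.sum_congr rfl fun φ _ => ?_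
      have hl : ∏ l, wgt p l (φ l) = t₀ ^ (∑ l, cost p l (φ l)) := by
        rw [hwgt]; exact Finset.prod_pow_eq_pow_sum _ _ t₀
      have hk : kap p * t₀ ^ (∑ l, cost p l (φ l)) = t₀ ^ ω (p, φ) := by
        rw [hkap, hω, pow_add]
      rw [hl, hA, hB]
      simp only [Matrix.of_apply, hc, hg, Fin.addCases_left, Fin.addCases_right]
      rw [← hk]
      ring
    rw [hmat]
    exact ht₀

/-- Size arithmetic of the class form: `h ≥ 3`, `m ≤ 2h`, `t ≤ h³`, `t·s ≤ 4h³` ⇒ size `≤ (2h)^8`. -/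
theorem gadgetJoin_size (h m t s : ℕ) (hh : 3 ≤ h) (hm : m ≤ h + h) (ht : t ≤ h * h * h)
    (hts : t * s ≤ 4 * (h * h * h)) :
    (h + h + 2) ^ 2 * (m * (3 * (h + h) + (t * (s * (3 * (h + h) + 1) + s) + t) + 1 + 1) + m) + (h + h + 1) ≤
      (h + h) ^ 8 := by
  have h1 : t * (s * (3 * (h + h) + 1) + s) + t ≤
      4 * (h * h * h) * (3 * (h + h) + 1) + 4 * (h * h * h) + h * h * h := by
    calc t * (s * (3 * (h + h) + 1) + s) + t = t * s * (3 * (h + h) + 1) + t * s + t := by ring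
      _ ≤ 4 * (h * h * h) * (3 * (h + h) + 1) + 4 * (h * h * h) + h * h * h := by gcongr
  have h2 : m * (3 * (h + h) + (t * (s * (3 * (h + h) + 1) + s) + t) + 1 + 1) + m ≤
      (h + h) * (3 * (h + h) + (4 * (h * h * h) * (3 * (h + h) + 1) + 4 * (h * h * h) + h * h * h) + 1 + 1) +
        (h + h) := by gcongr
  have e1 : h + h + 2 ≤ 3 * h := by omega
  have k1 : 3 * h ^ 7 ≤ h ^ 8 := le_trans (Nat.mul_le_mul_right _ hh) (le_of_eq (by ring))
  have k2 : 9 * h ^ 6 ≤ h ^ 8 :=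
    le_trans (Nat.mul_le_mul_right _ (le_trans (by norm_num) (Nat.pow_le_pow_left hh 2))) (le_of_eq (by ring))
  have k4 : 81 * h ^ 4 ≤ h ^ 8 :=
    le_trans (Nat.mul_le_mul_right _ (le_trans (by norm_num) (Nat.pow_le_pow_left hh 4))) (le_of_eq (by ring))
  have k5 : 243 * h ^ 3 ≤ h ^ 8 :=
    le_trans (Nat.mul_le_mul_right _ (le_trans (by norm_num) (Nat.pow_le_pow_left hh 5))) (le_of_eq (by ring))
  have k7 : 2187 * h ≤ h ^ 8 :=
    le_trans (Nat.mul_le_mul_right _ (le_trans (by norm_num) (Nat.pow_le_pow_left hh 7))) (le_of_eq (by ring))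
  have k8 : 6561 ≤ h ^ 8 := le_trans (by norm_num) (Nat.pow_le_pow_left hh 8)
  calc (h + h + 2) ^ 2 * (m * (3 * (h + h) + (t * (s * (3 * (h + h) + 1) + s) + t) + 1 + 1) + m) + (h + h + 1)
      ≤ (3 * h) ^ 2 * ((h + h) * (3 * (h + h) +
          (4 * (h * h * h) * (3 * (h + h) + 1) + 4 * (h * h * h) + h * h * h) + 1 + 1) + (h + h)) +
          (h + h + 1) := by gcongr
    _ = 432 * h ^ 7 + 162 * h ^ 6 + 108 * h ^ 4 + 54 * h ^ 3 + 2 * h + 1 := by ring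
    _ ≤ (h + h) ^ 8 := by
        have : (h + h) ^ 8 = 256 * h ^ 8 := by ring
        rw [this]
        linarith

/-- **THE GADGET JOIN DOOR (class form).** With `h ≥ 3`, `m ≤ 2h` pieces, `t ≤ h³` slots and `t·s ≤ 4h³` (slots × options)
the gadget witness lies in `SmallCircuits ℂ (h+h) 8`. -/
theorem partitionMinor_hit_of_gadgetJoin_mem (h m t s r : ℕ) (hh : 3 ≤ h) (hm : m ≤ h + h) (ht : t ≤ h * h * h)
    (hts : t * s ≤ 4 * (h * h * h)) (u w : Fin r → Finset (Fin h))
    (e : Fin r → Fin m × (Fin t → Fin s)) (he : Function.Injective e) (W : Fin m → ℕ)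
    (cost : Fin m → Fin t → Fin s → ℕ)
    (hthr : ∀ x : Fin m × (Fin t → Fin s), x ∉ Set.range e →
      ∀ k, W (e k).1 + ∑ l, cost (e k).1 l ((e k).2 l) < W x.1 + ∑ l, cost x.1 l (x.2 l))
    (cx cy : Fin m → Fin h → ℂ) (dx dy : Fin m → Fin t → Fin s → Fin h → ℂ)
    (hx : (Matrix.of fun i k : Fin r =>
      ∏ a ∈ u i, (cx (e k).1 a + ∑ l, dx (e k).1 l ((e k).2 l) a)).det ≠ 0)
    (hy : (Matrix.of fun j k : Fin r =>
      ∏ c ∈ w j, (cy (e k).1 c + ∑ l, dy (e k).1 l ((e k).2 l) c)).det ≠ 0) :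
    ∃ f ∈ SmallCircuits ℂ (h + h) 8,
      (Matrix.of fun i j : Fin r => MvPolynomial.coeff
        (∑ a ∈ u i, Finsupp.single (Fin.castAdd h a) 1 +
          ∑ c ∈ w j, Finsupp.single (Fin.natAdd h c) 1) f).det ≠ 0 := by
  obtain ⟨f, hdeg, hsize, hf⟩ :=
    partitionMinor_hit_of_gadgetJoin h m t s r u w e he W cost hthr cx cy dx dy hx hy
  exact ⟨f, ⟨hdeg, hsize.trans (gadgetJoin_size h m t s hh hm ht hts)⟩, hf⟩

/-- Over pairwise disjoint blocks the slot sums add up to the sum over the union `cols`. -/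
theorem sum_slots_eq_sum_cols {t s K : ℕ} (D : Fin t → Fin s → Finset (Fin K)) (φ : Fin t → Fin s)
    (cols : Finset (Fin K)) (hcols : cols = Finset.univ.biUnion fun l => D l (φ l))
    (hdisj : (Set.univ : Set (Fin t)).PairwiseDisjoint fun l => D l (φ l)) (f : Fin K → ℂ) :
    ∑ l, ∑ q ∈ D l (φ l), f q = ∑ q ∈ cols, f q := by
  rw [hcols, Finset.sum_biUnion (by simpa using hdisj)]

/-- **THE GADGET JOIN DOOR, state form (class `b = 8`).** Pieces `p < m ≤ 2h`, slots `l < t ≤ h³` with `s` options each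
(`t·s ≤ 4h³`), option `o` of slot `l` of piece `p` being the state set `D p l o ⊆ Fin K`; for every column `k`, with
`e k = (p, φ)`, the chosen sets `D p l (φ l)` are pairwise disjoint with union `cols k`. If `e` is an injective threshold
family of the slot-additive weight and state tables `T S : Fin m → Option (Fin K) → Fin h → ℂ` make BOTH block-additive
matrices `[∏_{a ∈ u i} (T p none a + Σ_{q ∈ cols k} T p (some q) a)]_{i,k}` (`p = (e k).1`) nonsingular, the layout `(u, w)`
is hit inside `SmallCircuits ℂ (h+h) 8`. (These are the matrices of `SimplexJoin.good_of_uniform_pieces_join`.) -/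
theorem partitionMinor_hit_of_gadgetStates_mem (h m t s K r : ℕ) (hh : 3 ≤ h) (hm : m ≤ h + h)
    (ht : t ≤ h * h * h) (hts : t * s ≤ 4 * (h * h * h)) (u w : Fin r → Finset (Fin h))
    (D : Fin m → Fin t → Fin s → Finset (Fin K))
    (e : Fin r → Fin m × (Fin t → Fin s)) (he : Function.Injective e) (W : Fin m → ℕ)
    (cost : Fin m → Fin t → Fin s → ℕ)
    (hthr : ∀ x : Fin m × (Fin t → Fin s), x ∉ Set.range e →
      ∀ k, W (e k).1 + ∑ l, cost (e k).1 l ((e k).2 l) < W x.1 + ∑ l, cost x.1 l (x.2 l))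
    (cols : Fin r → Finset (Fin K))
    (hcols : ∀ k, cols k = Finset.univ.biUnion fun l => D (e k).1 l ((e k).2 l))
    (hdisj : ∀ k, (Set.univ : Set (Fin t)).PairwiseDisjoint fun l => D (e k).1 l ((e k).2 l))
    (T S : Fin m → Option (Fin K) → Fin h → ℂ)
    (hx : (Matrix.of fun i k : Fin r =>
      ∏ a ∈ u i, (T (e k).1 none a + ∑ q ∈ cols k, T (e k).1 (some q) a)).det ≠ 0)
    (hy : (Matrix.of fun j k : Fin r =>
      ∏ c ∈ w j, (S (e k).1 none c + ∑ q ∈ cols k, S (e k).1 (some q) c)).det ≠ 0) :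
    ∃ f ∈ SmallCircuits ℂ (h + h) 8,
      (Matrix.of fun i j : Fin r => MvPolynomial.coeff
        (∑ a ∈ u i, Finsupp.single (Fin.castAdd h a) 1 +
          ∑ c ∈ w j, Finsupp.single (Fin.natAdd h c) 1) f).det ≠ 0 := by
  refine partitionMinor_hit_of_gadgetJoin_mem h m t s r hh hm ht hts u w e he W cost hthr
    (fun p => T p none) (fun p => S p none)
    (fun p l o a => ∑ q ∈ D p l o, T p (some q) a) (fun p l o c => ∑ q ∈ D p l o, S p (some q) c) ?_ ?_
  · have key : ∀ i k : Fin r,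
        ∏ a ∈ u i, (T (e k).1 none a + ∑ l, ∑ q ∈ D (e k).1 l ((e k).2 l), T (e k).1 (some q) a) =
          ∏ a ∈ u i, (T (e k).1 none a + ∑ q ∈ cols k, T (e k).1 (some q) a) := fun i k =>
      Finset.prod_congr rfl fun a _ => by
        rw [sum_slots_eq_sum_cols (D (e k).1) (e k).2 (cols k) (hcols k) (hdisj k)]
    simp only [key]
    exact hx
  · have key : ∀ j k : Fin r,
        ∏ c ∈ w j, (S (e k).1 none c + ∑ l, ∑ q ∈ D (e k).1 l ((e k).2 l), S (e k).1 (some q) c) =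
          ∏ c ∈ w j, (S (e k).1 none c + ∑ q ∈ cols k, S (e k).1 (some q) c) := fun j k =>
      Finset.prod_congr rfl fun c _ => by
        rw [sum_slots_eq_sum_cols (D (e k).1) (e k).2 (cols k) (hcols k) (hdisj k)]
    simp only [key]
    exact hy

end GadgetDoor

end

end Summit.ValiantsHypothesis.ValiantsHypothesis.Theorems.BarrierLever.HiddenStates
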